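import Mathlib
import HarnessLib

/-!
# Two-rowed semistandard tableaux: `#SST((d,d); n+1 letters) = h_d² − h_{d+1}h_{d−1}` by the Gessel–Viennot
# tail swap

Topic `Literature/Combinatorics/Enumerative`.  Source: M. Aigner, *A Course in Enumeration*, GTM 238, Springer
(2007) [Aigner2007] (held text `book:aigner2007-course-enumeration`): §5.4 Lemma 5.8 (Gessel–Viennot–Lindström:
"Let G be a directed acyclic graph … then det M = Σ_{vertex-disjoint path systems} sign(σ) w(P)", proved by
exchanging the tails of two intersecting paths after their first common point), §8.3 Thm. 8.7 (Jacobi–Trudi: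
`s_λ = det(h_{λ_i − i + j})`) and Thm. 8.8 (`s_λ(x₁,…,x_n) = Σ_{T ∈ SST(n, λ)} x^T`, proved by Lemma 5.8 with the
rows of a tableau as lattice paths: "the system is vertex-disjoint iff the associated tableau is an SST").
Specialised to `x = (1, …, 1)` and the two-rowed rectangle `λ = (d, d)`, these give the COUNT
`#SST(n, (d,d)) = h_d(1^n)² − h_{d+1}(1^n) h_{d−1}(1^n)`, `h_m(1^n) = C(n + m − 1, m)`.

This file proves that count directly and bijectively (no symmetric functions): for rows of length `k + 1` over a
finite linear order `α`,
* `words α m` — weakly increasing words (= the rows, = lattice paths), `sst2 α d` — pairs of rows with strictly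
  increasing columns (semistandard tableaux of shape `(d, d)`), `bad α k` — pairs of rows with a non-increasing
  column;
* §2–§4 the tail swap at the first bad column `t₀` (`swapC`, `swapE`: `(a, b) ↦ ((b₀…b_{t₀} a_{t₀}…a_k),
  (a₀…a_{t₀−1} b_{t₀+1}…b_k))`) and its inverse at the first meeting column (`unswapA`, `unswapB`, `firstMeet`),
  the four round-trip identities, monotonicity of the swapped rows, and **`card_bad`**:
  `#bad(k) = #words(k+2) · #words(k)` (`Finset.card_nbij'`) [cite: Aigner2007, Lemma 5.8 and Thm. 8.8 (proofs)];
* §5 `card_words`: `#words(m) = C(n + m, m)` over `Fin (n+1)` (shift to strictly increasing words, Mathlib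
  `Set.powersetCard.ofFinEmbEquiv`), and the main results **`card_sst2_add`** / **`card_sst2`**:
  `#SST((k+1,k+1); n+1 letters) = C(n+k+1, k+1)² − C(n+k+2, k+2)·C(n+k, k)`; `card_sst2_zero`.

Used by `Literature/RingTheory/MvPolynomial/PlueckerPostulation.lean` (Hilbert function of the Grassmannian
`G(2,n)`: semistandard monomials in the Plücker coordinates ↔ two-rowed tableaux). What is NOT formalised: the
general Gessel–Viennot lemma (arbitrary acyclic digraphs, `n` paths, signs), Schur functions, Jacobi–Trudi for
general `λ`. No named facts; 0 sorry.
-/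

namespace Literature.Combinatorics.Enumerative.TwoRowTableaux

open Finset

/-! ## §1 Weakly increasing words and two-rowed tableaux -/

section Defs

variable (α : Type*) [LinearOrder α]

/-- `Monotone` is decidable for words `Fin m → α` over a linear order. [folklore] -/
instance instDecidableMonotoneFin {m : ℕ} (w : Fin m → α) : Decidable (Monotone w) := by
  unfold Monotone; infer_instance

variable [Fintype α]

/-- The weakly increasing words `w₀ ≤ w₁ ≤ ⋯ ≤ w_{m−1}` of length `m` over the alphabet `α` (the rows of
semistandard tableaux; lattice paths with unit steps). [cite: Aigner2007, §8.3 (Definition before Thm. 8.8)] -/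
def words (m : ℕ) : Finset (Fin m → α) :=
  univ.filter fun w => Monotone w

/-- **Semistandard tableaux of the two-rowed rectangular shape `(d, d)`** over `α`: pairs of rows
`a, b` (weakly increasing words of length `d`) with strictly increasing columns `a t < b t`.
[cite: Aigner2007, §8.3 (Definition before Thm. 8.8)] -/
def sst2 (d : ℕ) : Finset ((Fin d → α) × (Fin d → α)) :=
  univ.filter fun p => Monotone p.1 ∧ Monotone p.2 ∧ ∀ t, p.1 t < p.2 t

/-- The "bad" pairs of rows: both weakly increasing, but some column fails to increase (`b t ≤ a t`) —
the intersecting path pairs of the Gessel–Viennot argument. [cite: Aigner2007, Thm. 8.8 (proof)] -/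
def bad (k : ℕ) : Finset ((Fin (k + 1) → α) × (Fin (k + 1) → α)) :=
  univ.filter fun p => Monotone p.1 ∧ Monotone p.2 ∧ ∃ t, p.2 t ≤ p.1 t

variable {α}

/-- Membership in `words`: weakly increasing. [cite: Aigner2007, §8.3 (Definition before Thm. 8.8: rows weakly increasing)] -/
@[simp] theorem mem_words {m : ℕ} {w : Fin m → α} : w ∈ words α m ↔ Monotone w := by
  simp [words]

/-- Membership in `sst2`: rows weakly increasing, columns strictly increasing.
[cite: Aigner2007, §8.3 (Definition before Thm. 8.8)] -/
@[simp] theorem mem_sst2 {d : ℕ} {p : (Fin d → α) × (Fin d → α)} :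
    p ∈ sst2 α d ↔ Monotone p.1 ∧ Monotone p.2 ∧ ∀ t, p.1 t < p.2 t := by
  simp [sst2]

/-- Membership in `bad`: some column fails to increase (the tableau is not semistandard).
[cite: Aigner2007, Thm. 8.8 (proof: intersecting path systems)] -/
@[simp] theorem mem_bad {k : ℕ} {p : (Fin (k + 1) → α) × (Fin (k + 1) → α)} :
    p ∈ bad α k ↔ Monotone p.1 ∧ Monotone p.2 ∧ ∃ t, p.2 t ≤ p.1 t := by
  simp [bad]

/-- Good + bad = all pairs of weakly increasing rows. [folklore] -/
private theorem card_sst2_add_card_bad (k : ℕ) :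
    (sst2 α (k + 1)).card + (bad α k).card = (words α (k + 1)).card ^ 2 := by
  rw [sq, ← Finset.card_product]
  have h := Finset.card_filter_add_card_filter_not
    (s := (words α (k + 1)) ×ˢ (words α (k + 1)))
    (fun p : (Fin (k + 1) → α) × (Fin (k + 1) → α) => ∀ t, p.1 t < p.2 t)
  rw [← h]
  congr 1
  · congr 1
    ext p
    simp only [mem_sst2, Finset.mem_filter, Finset.mem_product, mem_words, and_assoc]
  · congr 1
    ext p
    simp only [mem_bad, Finset.mem_filter, Finset.mem_product, mem_words, not_forall, not_lt,
      and_assoc]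

end Defs

/-! ## §2 The Gessel–Viennot tail swap -/

section Swap

variable {α : Type*} {k : ℕ}

/-- Tail swap, the long path: `c = (b₀, …, b_t, a_t, …, a_k)` (length `k + 2`).
[cite: Aigner2007, Lemma 5.8 (proof: exchanging the tails after the first common point)] -/
def swapC (t : ℕ) (a b : Fin (k + 1) → α) : Fin (k + 2) → α :=
  fun s => if (s : ℕ) ≤ t then b ⟨min s k, by omega⟩ else a ⟨s - 1, by omega⟩

/-- Tail swap, the short path: `e = (a₀, …, a_{t−1}, b_{t+1}, …, b_k)` (length `k`).
[cite: Aigner2007, Lemma 5.8 (proof)] -/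
def swapE (t : ℕ) (a b : Fin (k + 1) → α) : Fin k → α :=
  fun s => if (s : ℕ) < t then a ⟨s, by omega⟩ else b ⟨s + 1, by omega⟩

/-- Inverse swap, first row: `a = (e₀, …, e_{x−1}, c_{x+1}, …, c_{k+1})`. [cite: Aigner2007, Lemma 5.8 (proof)] -/
def unswapA (x : ℕ) (c : Fin (k + 2) → α) (e : Fin k → α) : Fin (k + 1) → α :=
  fun s => if h : (s : ℕ) < x ∧ (s : ℕ) < k then e ⟨s, h.2⟩ else c ⟨s + 1, by omega⟩

/-- Inverse swap, second row: `b = (c₀, …, c_x, e_x, …, e_{k−1})`. [cite: Aigner2007, Lemma 5.8 (proof)] -/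
def unswapB (x : ℕ) (c : Fin (k + 2) → α) (e : Fin k → α) : Fin (k + 1) → α :=
  fun s => if h : (s : ℕ) ≤ x then c ⟨s, by omega⟩ else e ⟨s - 1, by have := s.2; omega⟩

variable {a b : Fin (k + 1) → α} {c : Fin (k + 2) → α} {e : Fin k → α} {t x : ℕ}

/-- `c_s = b_s` for `s ≤ t` (`s ≤ k`). [folklore] -/
private theorem swapC_apply_of_le {s : Fin (k + 2)} (h : (s : ℕ) ≤ t) (hk : (s : ℕ) ≤ k) :
    swapC t a b s = b ⟨s, by omega⟩ := by
  unfold swapC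
  rw [if_pos h]
  exact congrArg b (Fin.ext (min_eq_left hk))

/-- `c_s = a_{s−1}` for `s > t`. [folklore] -/
private theorem swapC_apply_of_lt {s : Fin (k + 2)} (h : t < (s : ℕ)) :
    swapC t a b s = a ⟨s - 1, by omega⟩ := by
  unfold swapC
  rw [if_neg (not_le.mpr h)]

/-- `e_s = a_s` for `s < t`. [folklore] -/
private theorem swapE_apply_of_lt {s : Fin k} (h : (s : ℕ) < t) : swapE t a b s = a ⟨s, by omega⟩ := by
  unfold swapE
  rw [if_pos h]

/-- `e_s = b_{s+1}` for `s ≥ t`. [folklore] -/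
private theorem swapE_apply_of_le {s : Fin k} (h : t ≤ (s : ℕ)) : swapE t a b s = b ⟨s + 1, by omega⟩ := by
  unfold swapE
  rw [if_neg (not_lt.mpr h)]

/-- `a_s = e_s` for `s < x` (`s < k`). [folklore] -/
private theorem unswapA_apply_of_lt {s : Fin (k + 1)} (h : (s : ℕ) < x) (hk : (s : ℕ) < k) :
    unswapA x c e s = e ⟨s, hk⟩ := by
  unfold unswapA
  rw [dif_pos ⟨h, hk⟩]

/-- `a_s = c_{s+1}` for `s ≥ x`. [folklore] -/
private theorem unswapA_apply_of_le {s : Fin (k + 1)} (h : x ≤ (s : ℕ)) :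
    unswapA x c e s = c ⟨s + 1, by omega⟩ := by
  unfold unswapA
  rw [dif_neg (fun h' => absurd h'.1 (not_lt.mpr h))]

/-- `b_s = c_s` for `s ≤ x`. [folklore] -/
private theorem unswapB_apply_of_le {s : Fin (k + 1)} (h : (s : ℕ) ≤ x) :
    unswapB x c e s = c ⟨s, by omega⟩ := by
  unfold unswapB
  rw [dif_pos h]

/-- `b_s = e_{s−1}` for `s > x`. [folklore] -/
private theorem unswapB_apply_of_lt {s : Fin (k + 1)} (h : x < (s : ℕ)) :
    unswapB x c e s = e ⟨s - 1, by have := s.2; omega⟩ := by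
  unfold unswapB
  rw [dif_neg (not_le.mpr h)]

/-- Unswapping after swapping at the same column `t ≤ k` returns the first row (the tail swap is an involution).
[cite: Aigner2007, Lemma 5.8 (proof: "φ(φ𝒫) = 𝒫")] -/
theorem unswapA_swap (ht : t ≤ k) (a b : Fin (k + 1) → α) :
    unswapA t (swapC t a b) (swapE t a b) = a := by
  funext s
  have hs := s.2
  simp only [unswapA, swapC, swapE]
  split_ifs <;> first | omega | rfl

/-- Unswapping after swapping at the same column returns the second row (the tail swap is an involution).
[cite: Aigner2007, Lemma 5.8 (proof: "φ(φ𝒫) = 𝒫")] -/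
theorem unswapB_swap (t : ℕ) (a b : Fin (k + 1) → α) :
    unswapB t (swapC t a b) (swapE t a b) = b := by
  funext s
  have hs := s.2
  simp only [unswapB, swapC, swapE]
  split_ifs <;> first | omega | rfl | exact congrArg b (Fin.ext (by dsimp only; omega))

/-- Swapping after unswapping at the same column `x ≤ k` returns the long path (the tail swap is an involution).
[cite: Aigner2007, Lemma 5.8 (proof: "φ(φ𝒫) = 𝒫")] -/
theorem swapC_unswap (hx : x ≤ k) (c : Fin (k + 2) → α) (e : Fin k → α) :
    swapC x (unswapA x c e) (unswapB x c e) = c := by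
  funext s
  have hs := s.2
  simp only [unswapA, unswapB, swapC]
  split_ifs <;> first | omega | rfl | exact congrArg c (Fin.ext (by dsimp only; omega))

/-- Swapping after unswapping at the same column returns the short path (the tail swap is an involution).
[cite: Aigner2007, Lemma 5.8 (proof: "φ(φ𝒫) = 𝒫")] -/
theorem swapE_unswap (x : ℕ) (c : Fin (k + 2) → α) (e : Fin k → α) :
    swapE x (unswapA x c e) (unswapB x c e) = e := by
  funext s
  have hs := s.2
  simp only [unswapA, unswapB, swapE]
  split_ifs <;> first | omega | rfl

end Swap

/-! ## §3 The first bad column and the first meeting column -/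

section First

variable {α : Type*} [LinearOrder α] {k : ℕ}

/-- The first bad column `t₀ = min {t : b t ≤ a t}` of a pair of rows of length `k + 1`
(`= k + 1` when every column increases). [cite: Aigner2007, Lemma 5.8 (proof: "the first common point")] -/
def firstViol (a b : Fin (k + 1) → α) : ℕ :=
  Nat.find (⟨k + 1, fun h => absurd h (lt_irrefl _)⟩ : ∃ n, ∀ h : n < k + 1, b ⟨n, h⟩ ≤ a ⟨n, h⟩)

/-- `t₀ ≤ k + 1`. [folklore] -/
private theorem firstViol_le (a b : Fin (k + 1) → α) : firstViol a b ≤ k + 1 :=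
  Nat.find_min' _ fun h => absurd h (lt_irrefl _)

/-- Column `t₀` is bad (when it exists). [folklore] -/
private theorem firstViol_spec (a b : Fin (k + 1) → α) (h : firstViol a b < k + 1) :
    b ⟨firstViol a b, h⟩ ≤ a ⟨firstViol a b, h⟩ :=
  (Nat.find_spec (⟨k + 1, fun h => absurd h (lt_irrefl _)⟩ :
    ∃ n, ∀ h : n < k + 1, b ⟨n, h⟩ ≤ a ⟨n, h⟩)) h

/-- Columns before `t₀` are good. [folklore] -/
private theorem lt_of_lt_firstViol (a b : Fin (k + 1) → α) {n : ℕ} (hn : n < firstViol a b) (h : n < k + 1) :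
    a ⟨n, h⟩ < b ⟨n, h⟩ := by
  have hmin := Nat.find_min (⟨k + 1, fun h => absurd h (lt_irrefl _)⟩ :
    ∃ n, ∀ h : n < k + 1, b ⟨n, h⟩ ≤ a ⟨n, h⟩) hn
  push Not at hmin
  obtain ⟨_, hlt⟩ := hmin
  exact hlt

/-- A bad column bounds `t₀`. [folklore] -/
private theorem firstViol_le_of_le (a b : Fin (k + 1) → α) (t : Fin (k + 1)) (ht : b t ≤ a t) :
    firstViol a b ≤ t :=
  Nat.find_min' _ fun _ => ht

/-- Characterisation of `t₀ = t` (for `t ≤ k`). [folklore] -/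
private theorem firstViol_eq_iff (a b : Fin (k + 1) → α) {t : ℕ} (ht : t < k + 1) :
    firstViol a b = t ↔ b ⟨t, ht⟩ ≤ a ⟨t, ht⟩ ∧ ∀ n (hn : n < t), a ⟨n, by omega⟩ < b ⟨n, by omega⟩ := by
  rw [firstViol, Nat.find_eq_iff]
  refine ⟨fun ⟨h₁, h₂⟩ => ⟨h₁ ht, fun n hn => ?_⟩, fun ⟨h₁, h₂⟩ => ⟨fun _ => h₁, fun n hn hc => ?_⟩⟩
  · have h := h₂ n hn
    push Not at h
    obtain ⟨_, hlt⟩ := h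
    exact hlt
  · exact absurd (hc (by omega)) (not_le.mpr (h₂ n hn))

/-- The first column `x₀ = min ({x < k : c x ≤ e x} ∪ {k})` at which the swapped paths meet
(`c` of length `k + 2`, `e` of length `k`). [cite: Aigner2007, Lemma 5.8 (proof)] -/
def firstMeet (c : Fin (k + 2) → α) (e : Fin k → α) : ℕ :=
  Nat.find (⟨k, fun h => absurd h (lt_irrefl _)⟩ :
    ∃ n, ∀ h : n < k, c ⟨n, Nat.lt_of_lt_of_le h (by omega)⟩ ≤ e ⟨n, h⟩)

/-- `x₀ ≤ k`. [folklore] -/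
private theorem firstMeet_le (c : Fin (k + 2) → α) (e : Fin k → α) : firstMeet c e ≤ k :=
  Nat.find_min' _ fun h => absurd h (lt_irrefl _)

/-- At `x₀ < k` the paths meet: `c x₀ ≤ e x₀`. [folklore] -/
private theorem firstMeet_spec (c : Fin (k + 2) → α) (e : Fin k → α) (h : firstMeet c e < k) :
    c ⟨firstMeet c e, by omega⟩ ≤ e ⟨firstMeet c e, h⟩ :=
  (Nat.find_spec (⟨k, fun h => absurd h (lt_irrefl _)⟩ :
    ∃ n, ∀ h : n < k, c ⟨n, Nat.lt_of_lt_of_le h (by omega)⟩ ≤ e ⟨n, h⟩)) h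

/-- Before `x₀`: `e x < c x`. [folklore] -/
private theorem lt_of_lt_firstMeet (c : Fin (k + 2) → α) (e : Fin k → α) {n : ℕ} (hn : n < firstMeet c e)
    (h : n < k) : e ⟨n, h⟩ < c ⟨n, by omega⟩ := by
  have hmin := Nat.find_min (⟨k, fun h => absurd h (lt_irrefl _)⟩ :
    ∃ n, ∀ h : n < k, c ⟨n, Nat.lt_of_lt_of_le h (by omega)⟩ ≤ e ⟨n, h⟩) hn
  push Not at hmin
  obtain ⟨_, hlt⟩ := hmin
  exact hlt

/-- Characterisation of `x₀ = x` (for `x ≤ k`). [folklore] -/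
private theorem firstMeet_eq_iff (c : Fin (k + 2) → α) (e : Fin k → α) {x : ℕ} (hx : x ≤ k) :
    firstMeet c e = x ↔ (∀ h : x < k, c ⟨x, by omega⟩ ≤ e ⟨x, h⟩) ∧
      ∀ n (hn : n < x), e ⟨n, by omega⟩ < c ⟨n, by omega⟩ := by
  rw [firstMeet, Nat.find_eq_iff]
  refine ⟨fun ⟨h₁, h₂⟩ => ⟨h₁, fun n hn => ?_⟩, fun ⟨h₁, h₂⟩ => ⟨h₁, fun n hn hc => ?_⟩⟩
  · have h := h₂ n hn
    push Not at h
    obtain ⟨_, hlt⟩ := h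
    exact hlt
  · exact absurd (hc (by omega)) (not_le.mpr (h₂ n hn))

end First

/-! ## §4 The involution is a bijection `bad ≃ words (k+2) × words k` -/

section GV

variable {α : Type*} [LinearOrder α] {k : ℕ}

/-- The long path is weakly increasing (uses the bad column `b_t ≤ a_t`). [cite: Aigner2007, Lemma 5.8 (proof)] -/
theorem swapC_monotone {a b : Fin (k + 1) → α} (ha : Monotone a) (hb : Monotone b) {t : ℕ}
    (ht : t < k + 1) (hviol : b ⟨t, ht⟩ ≤ a ⟨t, ht⟩) : Monotone (swapC t a b) := by
  intro i j hij
  have hi := i.2; have hj := j.2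
  have hij' : (i : ℕ) ≤ j := hij
  by_cases h₁ : (j : ℕ) ≤ t
  · rw [swapC_apply_of_le (hij'.trans h₁) (by omega), swapC_apply_of_le h₁ (by omega)]
    exact hb (Fin.mk_le_mk.mpr hij')
  · by_cases h₂ : (i : ℕ) ≤ t
    · rw [swapC_apply_of_le h₂ (by omega), swapC_apply_of_lt (not_le.mp h₁)]
      calc b ⟨i, _⟩ ≤ b ⟨t, ht⟩ := hb (Fin.mk_le_mk.mpr h₂)
        _ ≤ a ⟨t, ht⟩ := hviol
        _ ≤ a ⟨(j : ℕ) - 1, _⟩ := ha (Fin.mk_le_mk.mpr (by omega))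
    · rw [swapC_apply_of_lt (not_le.mp h₂), swapC_apply_of_lt (not_le.mp h₁)]
      exact ha (Fin.mk_le_mk.mpr (by omega))

/-- The short path is weakly increasing (uses the good columns before `t`). [cite: Aigner2007, Lemma 5.8 (proof)] -/
theorem swapE_monotone {a b : Fin (k + 1) → α} (ha : Monotone a) (hb : Monotone b) {t : ℕ}
    (hgood : ∀ n, n < t → ∀ h : n < k + 1, a ⟨n, h⟩ < b ⟨n, h⟩) : Monotone (swapE t a b) := by
  intro i j hij
  have hi := i.2; have hj := j.2
  have hij' : (i : ℕ) ≤ j := hij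
  by_cases h₁ : (j : ℕ) < t
  · rw [swapE_apply_of_lt (lt_of_le_of_lt hij' h₁), swapE_apply_of_lt h₁]
    exact ha (Fin.mk_le_mk.mpr hij')
  · by_cases h₂ : (i : ℕ) < t
    · rw [swapE_apply_of_lt h₂, swapE_apply_of_le (not_lt.mp h₁)]
      calc a ⟨i, _⟩ ≤ b ⟨i, by omega⟩ := (hgood i h₂ _).le
        _ ≤ b ⟨(j : ℕ) + 1, _⟩ := hb (Fin.mk_le_mk.mpr (by omega))
    · rw [swapE_apply_of_le (not_lt.mp h₂), swapE_apply_of_le (not_lt.mp h₁)]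
      exact hb (Fin.mk_le_mk.mpr (by omega))

/-- The unswapped first row is weakly increasing (uses the columns before `x`). [cite: Aigner2007, Lemma 5.8 (proof)] -/
theorem unswapA_monotone {c : Fin (k + 2) → α} {e : Fin k → α} (hc : Monotone c) (he : Monotone e)
    {x : ℕ} (hx : x ≤ k) (hgood : ∀ n, n < x → ∀ h : n < k, e ⟨n, h⟩ < c ⟨n, by omega⟩) :
    Monotone (unswapA x c e) := by
  intro i j hij
  have hi := i.2; have hj := j.2
  have hij' : (i : ℕ) ≤ j := hij
  by_cases h₁ : (j : ℕ) < x
  · rw [unswapA_apply_of_lt (lt_of_le_of_lt hij' h₁) (by omega), unswapA_apply_of_lt h₁ (by omega)]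
    exact he (Fin.mk_le_mk.mpr hij')
  · by_cases h₂ : (i : ℕ) < x
    · rw [unswapA_apply_of_lt h₂ (by omega), unswapA_apply_of_le (not_lt.mp h₁)]
      calc e ⟨i, _⟩ ≤ c ⟨i, by omega⟩ := (hgood i h₂ _).le
        _ ≤ c ⟨(j : ℕ) + 1, _⟩ := hc (Fin.mk_le_mk.mpr (by omega))
    · rw [unswapA_apply_of_le (not_lt.mp h₂), unswapA_apply_of_le (not_lt.mp h₁)]
      exact hc (Fin.mk_le_mk.mpr (by omega))

/-- The unswapped second row is weakly increasing (uses the meeting column `c_x ≤ e_x`).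
[cite: Aigner2007, Lemma 5.8 (proof)] -/
theorem unswapB_monotone {c : Fin (k + 2) → α} {e : Fin k → α} (hc : Monotone c) (he : Monotone e)
    {x : ℕ} (hx : x ≤ k) (hmeet : ∀ h : x < k, c ⟨x, by omega⟩ ≤ e ⟨x, h⟩) :
    Monotone (unswapB x c e) := by
  intro i j hij
  have hi := i.2; have hj := j.2
  have hij' : (i : ℕ) ≤ j := hij
  by_cases h₁ : (j : ℕ) ≤ x
  · rw [unswapB_apply_of_le (hij'.trans h₁), unswapB_apply_of_le h₁]
    exact hc (Fin.mk_le_mk.mpr hij')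
  · by_cases h₂ : (i : ℕ) ≤ x
    · rw [unswapB_apply_of_le h₂, unswapB_apply_of_lt (not_le.mp h₁)]
      calc c ⟨i, _⟩ ≤ c ⟨x, by omega⟩ := hc (Fin.mk_le_mk.mpr h₂)
        _ ≤ e ⟨x, by omega⟩ := hmeet (by omega)
        _ ≤ e ⟨(j : ℕ) - 1, _⟩ := he (Fin.mk_le_mk.mpr (by omega))
    · rw [unswapB_apply_of_lt (not_le.mp h₂), unswapB_apply_of_lt (not_le.mp h₁)]
      exact he (Fin.mk_le_mk.mpr (by omega))

/-- The Gessel–Viennot map on a bad pair: swap the tails at the first bad column.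
[cite: Aigner2007, Lemma 5.8 (proof)] -/
def gvFwd (p : (Fin (k + 1) → α) × (Fin (k + 1) → α)) : (Fin (k + 2) → α) × (Fin k → α) :=
  (swapC (firstViol p.1 p.2) p.1 p.2, swapE (firstViol p.1 p.2) p.1 p.2)

/-- Its inverse: swap back at the first meeting column. [cite: Aigner2007, Lemma 5.8 (proof)] -/
def gvBwd (q : (Fin (k + 2) → α) × (Fin k → α)) : (Fin (k + 1) → α) × (Fin (k + 1) → α) :=
  (unswapA (firstMeet q.1 q.2) q.1 q.2, unswapB (firstMeet q.1 q.2) q.1 q.2)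

/-- On a bad pair the first bad column is `≤ k`. [folklore] -/
private theorem firstViol_le_of_mem_bad [Fintype α] {p : (Fin (k + 1) → α) × (Fin (k + 1) → α)}
    (hp : p ∈ bad α k) : firstViol p.1 p.2 ≤ k := by
  obtain ⟨-, -, t, ht⟩ := mem_bad.mp hp
  exact (firstViol_le_of_le p.1 p.2 t ht).trans (Nat.lt_succ_iff.mp t.2)

/-- After the swap, the first meeting column is the old first bad column.
[cite: Aigner2007, Lemma 5.8 (proof: "the first common point is unchanged")] -/
theorem firstMeet_gvFwd {a b : Fin (k + 1) → α} (hb : Monotone b) {t : ℕ} (ht : t ≤ k)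
    (hfv : firstViol a b = t) : firstMeet (swapC t a b) (swapE t a b) = t := by
  rw [firstMeet_eq_iff _ _ ht]
  refine ⟨fun h => ?_, fun n hn => ?_⟩
  · calc swapC t a b ⟨t, _⟩ = b ⟨t, by omega⟩ := swapC_apply_of_le (s := ⟨t, by omega⟩) le_rfl ht
      _ ≤ b ⟨t + 1, by omega⟩ := hb (Fin.mk_le_mk.mpr (by omega))
      _ = swapE t a b ⟨t, h⟩ := (swapE_apply_of_le (s := ⟨t, h⟩) le_rfl).symm
  · calc swapE t a b ⟨n, _⟩ = a ⟨n, by omega⟩ := swapE_apply_of_lt (s := ⟨n, by omega⟩) hn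
      _ < b ⟨n, by omega⟩ := lt_of_lt_firstViol a b (hfv ▸ hn) _
      _ = swapC t a b ⟨n, _⟩ := (swapC_apply_of_le (s := ⟨n, by omega⟩) hn.le (show n ≤ k by omega)).symm

/-- After unswapping, the first bad column is the old first meeting column. [cite: Aigner2007, Lemma 5.8 (proof)] -/
theorem firstViol_gvBwd {c : Fin (k + 2) → α} {e : Fin k → α} (hc : Monotone c) {x : ℕ} (hx : x ≤ k)
    (hfm : firstMeet c e = x) : firstViol (unswapA x c e) (unswapB x c e) = x := by
  rw [firstViol_eq_iff _ _ (by omega)]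
  refine ⟨?_, fun n hn => ?_⟩
  · calc unswapB x c e ⟨x, _⟩ = c ⟨x, by omega⟩ := unswapB_apply_of_le (s := ⟨x, by omega⟩) le_rfl
      _ ≤ c ⟨x + 1, by omega⟩ := hc (Fin.mk_le_mk.mpr (by omega))
      _ = unswapA x c e ⟨x, _⟩ := (unswapA_apply_of_le (s := ⟨x, by omega⟩) le_rfl).symm
  · calc unswapA x c e ⟨n, _⟩ = e ⟨n, by omega⟩ :=
        unswapA_apply_of_lt (s := ⟨n, by omega⟩) hn (show n < k by omega)
      _ < c ⟨n, by omega⟩ := lt_of_lt_firstMeet c e (hfm ▸ hn) _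
      _ = unswapB x c e ⟨n, _⟩ := (unswapB_apply_of_le (s := ⟨n, by omega⟩) hn.le).symm

variable [Fintype α]

/-- `gvFwd` maps bad pairs to pairs of weakly increasing words. [cite: Aigner2007, Lemma 5.8 (proof)] -/
theorem gvFwd_mem {p : (Fin (k + 1) → α) × (Fin (k + 1) → α)} (hp : p ∈ bad α k) :
    gvFwd p ∈ (words α (k + 2)) ×ˢ (words α k) := by
  have ht := firstViol_le_of_mem_bad hp
  obtain ⟨ha, hb, -⟩ := mem_bad.mp hp
  rw [Finset.mem_product, mem_words, mem_words]
  exact ⟨swapC_monotone ha hb (by omega) (firstViol_spec p.1 p.2 (by omega)),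
    swapE_monotone ha hb fun n hn h => lt_of_lt_firstViol p.1 p.2 hn h⟩

/-- `gvBwd` maps pairs of weakly increasing words to bad pairs. [cite: Aigner2007, Lemma 5.8 (proof)] -/
theorem gvBwd_mem {q : (Fin (k + 2) → α) × (Fin k → α)} (hq : q ∈ (words α (k + 2)) ×ˢ (words α k)) :
    gvBwd q ∈ bad α k := by
  rw [Finset.mem_product, mem_words, mem_words] at hq
  obtain ⟨hc, he⟩ := hq
  have hx := firstMeet_le q.1 q.2
  refine mem_bad.mpr ⟨unswapA_monotone hc he hx fun n hn h => lt_of_lt_firstMeet q.1 q.2 hn h,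
    unswapB_monotone hc he hx fun h => firstMeet_spec q.1 q.2 h, ⟨firstMeet q.1 q.2, by omega⟩, ?_⟩
  calc unswapB (firstMeet q.1 q.2) q.1 q.2 ⟨firstMeet q.1 q.2, _⟩ = q.1 ⟨firstMeet q.1 q.2, by omega⟩ :=
        unswapB_apply_of_le (s := ⟨firstMeet q.1 q.2, by omega⟩) le_rfl
    _ ≤ q.1 ⟨firstMeet q.1 q.2 + 1, by omega⟩ := hc (Fin.mk_le_mk.mpr (by omega))
    _ = unswapA (firstMeet q.1 q.2) q.1 q.2 ⟨firstMeet q.1 q.2, _⟩ :=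
        (unswapA_apply_of_le (s := ⟨firstMeet q.1 q.2, by omega⟩) le_rfl).symm

/-- `gvBwd ∘ gvFwd = id` on bad pairs. [cite: Aigner2007, Lemma 5.8 (proof: the tail swap is an involution)] -/
theorem gvBwd_gvFwd {p : (Fin (k + 1) → α) × (Fin (k + 1) → α)} (hp : p ∈ bad α k) :
    gvBwd (gvFwd p) = p := by
  have ht := firstViol_le_of_mem_bad hp
  obtain ⟨-, hb, -⟩ := mem_bad.mp hp
  obtain ⟨a, b⟩ := p
  simp only [gvBwd, gvFwd, firstMeet_gvFwd hb ht rfl]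
  rw [unswapA_swap ht, unswapB_swap]

/-- `gvFwd ∘ gvBwd = id` on pairs of words. [cite: Aigner2007, Lemma 5.8 (proof)] -/
theorem gvFwd_gvBwd {q : (Fin (k + 2) → α) × (Fin k → α)} (hq : q ∈ (words α (k + 2)) ×ˢ (words α k)) :
    gvFwd (gvBwd q) = q := by
  rw [Finset.mem_product, mem_words, mem_words] at hq
  obtain ⟨hc, -⟩ := hq
  obtain ⟨c, e⟩ := q
  have hx := firstMeet_le c e
  simp only [gvFwd, gvBwd, firstViol_gvBwd hc hx rfl]
  rw [swapC_unswap hx, swapE_unswap]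

/-- **The Gessel–Viennot bijection for two rows**: bad pairs of rows of length `k + 1` are equinumerous
with pairs (word of length `k + 2`, word of length `k`). [cite: Aigner2007, Lemma 5.8 and Thm. 8.8 (proof)] -/
theorem card_bad (α : Type*) [LinearOrder α] [Fintype α] (k : ℕ) :
    (bad α k).card = (words α (k + 2)).card * (words α k).card := by
  rw [← Finset.card_product]
  exact Finset.card_nbij' gvFwd gvBwd (fun p hp => gvFwd_mem hp) (fun q hq => gvBwd_mem hq)
    (fun p hp => gvBwd_gvFwd hp) (fun q hq => gvFwd_gvBwd hq)

end GV

/-! ## §5 Counting: `#words(m) = C(n+m, m)` over `Fin (n+1)`, and the two-rowed tableau count -/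

section Count

/-- `StrictMono` is decidable for words over a linear order. [folklore] -/
instance instDecidableStrictMonoFin {α : Type*} [LinearOrder α] {m : ℕ} (w : Fin m → α) :
    Decidable (StrictMono w) := by
  unfold StrictMono; infer_instance

/-- Strictly increasing words of length `m` over `Fin N` are counted by `C(N, m)` (order embeddings
`Fin m ↪o Fin N` ↔ `m`-subsets, Mathlib `Set.powersetCard.ofFinEmbEquiv`). [folklore] -/
private theorem card_filter_strictMono (N m : ℕ) :
    ((univ : Finset (Fin m → Fin N)).filter fun w => StrictMono w).card = N.choose m := by
  rw [← Fintype.card_subtype]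
  let e : {w : Fin m → Fin N // StrictMono w} ≃ (Fin m ↪o Fin N) :=
    { toFun := fun w ↦ OrderEmbedding.ofStrictMono w.1 w.2
      invFun := fun f ↦ ⟨f, f.strictMono⟩
      left_inv := fun _ ↦ rfl
      right_inv := fun _ ↦ by ext; rfl }
  rw [Fintype.card_congr (e.trans Set.powersetCard.ofFinEmbEquiv), ← Nat.card_eq_fintype_card,
    Set.powersetCard.card, Nat.card_eq_fintype_card, Fintype.card_fin]

/-- A strictly increasing word climbs at least as fast as its index: `g t + j ≤ g (t + j)`. [folklore] -/
private theorem strictMono_gap {m N : ℕ} {g : Fin m → Fin N} (hg : StrictMono g) (t : Fin m) (j : ℕ)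
    (hj : (t : ℕ) + j < m) : (g t : ℕ) + j ≤ g ⟨t + j, hj⟩ := by
  induction j with
  | zero => exact le_of_eq rfl
  | succ j ih =>
    have h₁ := ih (by omega)
    have h₂ : g ⟨t + j, by omega⟩ < g ⟨t + (j + 1), hj⟩ := hg (Fin.mk_lt_mk.mpr (by omega))
    rw [Fin.lt_def] at h₂
    omega

/-- The shift `f ↦ (t ↦ f t + t)` turning weakly increasing words over `Fin (n+1)` into strictly increasing
words over `Fin (n+m)`. [folklore] -/
private def shiftUp (n m : ℕ) (f : Fin m → Fin (n + 1)) : Fin m → Fin (n + m) :=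
  fun t => ⟨f t + t, by have := (f t).2; have := t.2; omega⟩

/-- Its inverse `g ↦ (t ↦ g t − t)` (truncated to stay total). [folklore] -/
private def shiftDown (n m : ℕ) (g : Fin m → Fin (n + m)) : Fin m → Fin (n + 1) :=
  fun t => ⟨min ((g t : ℕ) - t) n, by omega⟩

/-- **Weakly increasing words of length `m` over an alphabet of `n + 1` letters: `C(n + m, m)`**
(multisets; `h_m(1, …, 1)`). [cite: Aigner2007, Thm. 8.8 (proof: path matrix entries `h_{λ_j − j + i}`)] -/
theorem card_words (n m : ℕ) : (words (Fin (n + 1)) m).card = (n + m).choose m := by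
  rw [← card_filter_strictMono (n + m) m]
  refine Finset.card_nbij' (shiftUp n m) (shiftDown n m) (fun f hf => ?_) (fun g hg => ?_)
    (fun f hf => ?_) (fun g hg => ?_)
  · rw [Finset.mem_coe, mem_words] at hf
    rw [Finset.mem_coe, Finset.mem_filter]
    refine ⟨Finset.mem_univ _, fun s t hst => ?_⟩
    have h : (f s : ℕ) ≤ f t := hf hst.le
    rw [Fin.lt_def] at hst
    show (⟨(f s : ℕ) + s, _⟩ : Fin (n + m)) < ⟨f t + t, _⟩
    exact Fin.mk_lt_mk.mpr (by omega)
  · rw [Finset.mem_coe, Finset.mem_filter] at hg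
    obtain ⟨-, hg⟩ := hg
    rw [Finset.mem_coe, mem_words]
    intro s t hst
    rw [Fin.le_def] at hst
    have gap := strictMono_gap hg s (t - s) (by omega)
    have e : (⟨(s : ℕ) + (t - s), by omega⟩ : Fin m) = t := Fin.ext (by simp only; omega)
    rw [e] at gap
    show (⟨min ((g s : ℕ) - s) n, _⟩ : Fin (n + 1)) ≤ ⟨min ((g t : ℕ) - t) n, _⟩
    exact Fin.mk_le_mk.mpr (by omega)
  · funext t
    have := (f t).2
    simp only [shiftUp, shiftDown]
    ext
    dsimp only
    omega
  · rw [Finset.mem_coe, Finset.mem_filter] at hg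
    obtain ⟨-, hg⟩ := hg
    funext t
    have ht := t.2
    have gap₁ := strictMono_gap hg ⟨0, by omega⟩ t (by simp only; omega)
    have e : (⟨(0 : ℕ) + t, by omega⟩ : Fin m) = t := Fin.ext (by simp)
    rw [e] at gap₁
    have gap₂ := strictMono_gap hg t (m - 1 - t) (by omega)
    have hlt : (g ⟨(t : ℕ) + (m - 1 - t), by omega⟩ : ℕ) < n + m := (g _).2
    simp only [shiftUp, shiftDown]
    ext
    dsimp only at gap₁ ⊢
    omega

/-- With no columns there is exactly one (empty) tableau (`s_∅ = 1`). [cite: Aigner2007, Thm. 8.8 (λ = ∅)] -/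
theorem card_sst2_zero (α : Type*) [LinearOrder α] [Fintype α] : (sst2 α 0).card = 1 := by
  rw [sst2, Finset.filter_true_of_mem fun p _ => ⟨fun a _ _ => a.elim0, fun a _ _ => a.elim0, fun t => t.elim0⟩,
    Finset.card_univ, Fintype.card_prod, Fintype.card_fun]
  simp

/-- **Two-rowed semistandard tableaux of shape `(k+1, k+1)` over `n + 1` letters**:
`#SST + C(n+k+2, k+2)·C(n+k, k) = C(n+k+1, k+1)²` — Jacobi–Trudi `s_{(d,d)} = h_d² − h_{d+1}h_{d−1}` at
`x = (1, …, 1)` via the Gessel–Viennot involution.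
[cite: Aigner2007, Thm. 8.7 (Jacobi–Trudi) and Thm. 8.8, λ = (d, d), x = (1,…,1)] -/
theorem card_sst2_add (n k : ℕ) :
    (sst2 (Fin (n + 1)) (k + 1)).card + (n + k + 2).choose (k + 2) * (n + k).choose k =
      ((n + k + 1).choose (k + 1)) ^ 2 := by
  have h₁ := card_words n (k + 2)
  have h₂ := card_words n k
  have h₃ := card_words n (k + 1)
  rw [show n + (k + 2) = n + k + 2 by ring] at h₁
  rw [show n + (k + 1) = n + k + 1 by ring] at h₃
  rw [← h₁, ← h₂, ← h₃, ← card_bad]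
  exact card_sst2_add_card_bad k

/-- The same count in closed (subtractive) form: `#SST((d,d), n+1 letters) = C(n+d, d)² − C(n+d+1, d+1)·C(n+d−1, d−1)`
for `d = k + 1`. [cite: Aigner2007, Thm. 8.7 and Thm. 8.8, λ = (d, d), x = (1,…,1)] -/
theorem card_sst2 (n k : ℕ) :
    (sst2 (Fin (n + 1)) (k + 1)).card =
      ((n + k + 1).choose (k + 1)) ^ 2 - (n + k + 2).choose (k + 2) * (n + k).choose k := by
  have := card_sst2_add n k
  omega

end Count

end Literature.Combinatorics.Enumerative.TwoRowTableaux
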